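import Summits.HodgeConjecture.HodgeConjecture.Theorems.HeckePrymWeilHeckePrymAnchorsOfDeligneWeilFamily
import Summits.HodgeConjecture.HodgeConjecture.Theorems.HeckePrymWeilHeckePrymAnchorsDeligneWeilFamilyOfKAction
import HarnessLib

/-!
# `HeckePrymAnchors` is a corollary of the route decl `DeligneWeilFamily` — BY NAME (line `Sketch`, v21)

Line `Sketch` of crux `HeckePrymAnchors` (item stmt-HodgeConjecture-14496, route `HeckePrymWeil`),
continuation lead c18 (2026-08-16). Since route rev 19/20 (22:19Z) the route file
`Theses/HeckePrymWeil.lean` RENDERS the promoted item stmt-HodgeConjecture-16866 as the decl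
`Summit.HodgeConjecture.HodgeConjecture.Theses.HeckePrymWeil.DeligneWeilFamily` (Deligne's abelian
scheme with `𝒪_K`-action through the balanced `(X, Φ)`, global-class rendering;
[Deligne1982HodgeCycles], proof of Thm. 4.8, pp. 47–51). The closures landed by lead c14 were
necessarily stated against that item's statement written out VERBATIM (the decl did not exist):
`heckePrymAnchors_of_deligneWeilFamily` (p127207) and `deligneWeilFamily_of_kAction` (p127290).

This file restates them against the ROUTE DECLS BY NAME, so that in the route's own vocabulary

* `heckePrymAnchors_of_deligneWeilFamilyDecl : DeligneWeilFamily → HeckePrymAnchors` — the crux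
  `HeckePrymAnchors` (stmt-14496) is a COROLLARY of the crux `DeligneWeilFamily` (stmt-16866): the
  certificate for the route-choice retriage "14496 crux → support (derived from 16866)", and the
  one-line closing term of this crux once `DeligneWeilFamily_holds` is appended to the route file
  (`HeckePrymAnchors_of := heckePrymAnchors_of_deligneWeilFamilyDecl DeligneWeilFamily_holds`);
* `deligneWeilFamilyDecl_iff_kAction : DeligneWeilFamily ↔ deligne1982_weilFamily_kAction` — the
  route decl is, by name, equivalent to the Literature named fact
  `HodgeTheory.deligne1982_weilFamily_kAction` (so `deligne1982_weilFamily_kAction_holds`, when it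
  lands, closes item 16866 by `deligneWeilFamilyDecl_iff_kAction.2`).

Both are definitional unfoldings of the decl (its body is the item's signature, character for
character) followed by the landed closures; no `sorry`, no definition, no new axiom.
-/

noncomputable section

-- every declaration of this problem lives in `Summit.HodgeConjecture.HodgeConjecture.…` (summit = sub-problem)
set_option linter.dupNamespace false

namespace Summit.HodgeConjecture.HodgeConjecture.Theorems.HeckePrymWeilLine

open Literature.AlgebraicGeometry.HodgeTheory
open Summit.HodgeConjecture.HodgeConjecture.Theses.HeckePrymWeil

/-- **The crux `HeckePrymAnchors` (stmt-HodgeConjecture-14496) is a corollary of the route decl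
`DeligneWeilFamily` (stmt-HodgeConjecture-16866)**, by name: unfold the decl (its body is the item's
statement verbatim) and apply the landed closure `heckePrymAnchors_of_deligneWeilFamily`
(global class ⇒ flat continuous section ⇒ `deligne1982_weilFamily_kAction` ⇒ the crux, via the aimed
companion Weil surface, the discharged Deligne-1968 engine, isogeny transfer; unbalanced `A` anchors
only `0`). [cite: Deligne1982HodgeCycles, proof of Thm. 4.8 (pp. 47–52) with Prop. 4.4]
[cite: vanGeemen1994HodgeAV, Lemma 5.2 (4), 5.3–5.11] -/
theorem heckePrymAnchors_of_deligneWeilFamilyDecl : Summit.HodgeConjecture.HodgeConjecture.Theses.HeckePrymWeil.DeligneWeilFamily → Summit.HodgeConjecture.HodgeConjecture.Theses.HeckePrymWeil.HeckePrymAnchors :=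
  fun h => heckePrymAnchors_of_deligneWeilFamily h

/-- **The route decl `DeligneWeilFamily` (stmt-HodgeConjecture-16866) is equivalent, by name, to the
Literature named fact `deligne1982_weilFamily_kAction`** (Deligne's family in its continuous-section
rendering): `→` is `kAction_of_deligneWeilFamily` (`σ := globalSection f (2k) W`), `←` is
`deligneWeilFamily_of_kAction` (the flat section is the restriction of ONE global class, by the
discharged `deligne1968_invariantClass_fromTotalSpace_holds`).
[cite: Deligne1982HodgeCycles, proof of Thm. 4.8 (pp. 47–51)] -/
theorem deligneWeilFamilyDecl_iff_kAction : Summit.HodgeConjecture.HodgeConjecture.Theses.HeckePrymWeil.DeligneWeilFamily ↔ Literature.AlgebraicGeometry.HodgeTheory.deligne1982_weilFamily_kAction :=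
  ⟨fun h => kAction_of_deligneWeilFamily h, fun h => deligneWeilFamily_of_kAction h⟩

end Summit.HodgeConjecture.HodgeConjecture.Theorems.HeckePrymWeilLine

end
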